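import Mathlib.Algebra.Polynomial.Eval.Defs
import Literature.Computability.Cryptography.NaorReingoldFamily
import Literature.Computability.Complexity.ThresholdGadgets
import HarnessLib

/-!
# The hashed Naor–Reingold family lies in `TC⁰`, given Theorem 4.5

The `TC⁰` half of `HardPRFInTC0OfSubexpDDH` (`Literature/Barriers/PneNP/NaturalProofsTC0DDH.lean`),
RELATIVE to the named fact `Literature.Computability.Cryptography.NaorReingold2004_thm45`
(Naor–Reingold 2004, Thm. 4.5, p. 252: every bit of `f_{P,Q,g,ā}` has constant-depth
polynomial-size threshold circuits): every member of the keyed family `Seq.family`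
(`NaorReingoldFamily.lean`) — at input length `n`, the inner-product hash `⟨r, bin(f_{P,Q,g,K}(x))⟩`
of the Naor–Reingold value at security parameter `m = n^k` — is decided by a `tcBasis` circuit
family of constant depth `d + 5` and polynomial size (`familyIn_TC0`):

* the `m`-bit instance is evaluated on `n ≤ m` inputs by substituting constants for the unused
  inputs (`ACRealOver.comp`; the key exponents are first reduced mod `Q = ord g`, which does not
  change the function, `nrFun_ext`);
* the hash bit `⊕_j (r_j ∧ bit_j)` is the parity of a unit-weight sum of the `m` (masked) output
  bits, one threshold layer plus `AC⁰` logic (`ThresholdGadgets.ACVecOver.wsumPred`, Vollmer 1999,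
  proof of Thm. 1.37), depth `+ 4`;
* junk lengths (no DDH instance) get the constant circuit.

## References

* M. Naor, O. Reingold, J. ACM 51 (2004), §4.2 and Thm. 4.5 (pp. 251–252).
* H. Vollmer, *Introduction to Circuit Complexity* (1999), §1.4.1 (Thm. 1.37), §4.5.2.
* S. Arora, B. Barak, *Computational Complexity: A Modern Approach* (2009), §14.4.2, §23.3.
-/

noncomputable section

namespace Literature.Computability.Cryptography

open Finset Polynomial Literature.Computability.MetaComplexity Literature.Computability.Complexity
  Literature.Barriers.PneNP

namespace NaorReingold

namespace Seq

variable (σ : Seq)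

/-! ### Evaluating an `m`-input instance on `n ≤ m` inputs -/

/-- Padding an `n`-bit input with zeros to `m` bits. [folklore] -/
def ext (n m : ℕ) (x : Fin n → Bool) : Fin m → Bool := fun i => if h : i.val < n then x ⟨i.val, h⟩ else false

/-- The key exponents reduced mod `Q` and padded with zeros to `m + 1` entries. [folklore] -/
def extKey (n m Q : ℕ) (K : Fin (n + 1) → ℕ) : Fin (m + 1) → ℕ :=
  fun i => if h : i.val ≤ n then K ⟨i.val, Nat.lt_succ_of_le h⟩ % Q else 0

variable {σ}

/-- The padded reduced key has entries `< Q`. [folklore] -/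
theorem extKey_lt {n m Q : ℕ} (hQ : 0 < Q) (K : Fin (n + 1) → ℕ) (i : Fin (m + 1)) : extKey n m Q K i < Q := by
  unfold extKey; split
  · exact Nat.mod_lt _ hQ
  · exact hQ

/-- A product over `Fin m` of a function supported below `n ≤ m` is the product over `Fin n`. [folklore] -/
theorem prod_dite_lt {n m : ℕ} (hnm : n ≤ m) (f : Fin n → ℕ) :
    (∏ j : Fin m, if h : j.val < n then f ⟨j.val, h⟩ else 1) = ∏ i : Fin n, f i := by
  rw [← Finset.prod_subset (Finset.subset_univ (univ.map (Fin.castLEEmb hnm)))]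
  · rw [Finset.prod_map]
    refine Finset.prod_congr rfl fun i _ => ?_
    simp [Fin.castLEEmb]
  · intro j _ hj
    have : ¬ j.val < n := fun h => hj (Finset.mem_map.2 ⟨⟨j.val, h⟩, mem_univ _, Fin.ext rfl⟩)
    simp [this]

/-- **Evaluating on padded inputs with the padded reduced key gives the same value**
(`g^{ord g} = 1`). [cite: NaorReingold2004, Construction 4.1 (p. 245)] -/
theorem nrFun_ext {n m P Q g : ℕ} (hnm : n ≤ m) (hQ : 0 < Q) (hg : (g : ZMod P) ^ Q = 1)
    (K : Fin (n + 1) → ℕ) (x : Fin n → Bool) :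
    nrFun P g K x = nrFun P g (extKey n m Q K) (ext n m x) := by
  let ppn : Params := ⟨n, m, P, Q, g, hQ⟩
  have h1 : nrFun P g K x = nrFun P g (fun i => K i % Q) x := Params.nrFun_mod (pp := ppn) hg K x
  rw [h1, nrFun, nrFun]
  congr 1
  have h0 : extKey n m Q K 0 = K 0 % Q := by simp [extKey]
  rw [h0]
  congr 1
  rw [← prod_dite_lt hnm (fun i => if x i = true then K i.succ % Q else 1)]
  refine Finset.prod_congr rfl fun j _ => ?_
  by_cases hj : j.val < n
  · have hsucc : (extKey n m Q K j.succ) = K (⟨j.val, hj⟩ : Fin n).succ % Q := by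
      simp only [extKey, Fin.val_succ, show j.val + 1 ≤ n from hj, dif_pos]
      rfl
    simp [ext, hj, hsucc]
  · simp [ext, hj]

/-! ### The circuits -/

/-- Gate count at security parameter `m` for the size bound `p` of Theorem 4.5. [folklore] -/
def tcSize (p : Polynomial ℕ) (m : ℕ) : ℕ := (m + 1) * (4 * (m + (m + 1)) + 11) + 1 + m * (p.eval m + m)

/-- The same as a polynomial in the input length `n` (`m = n^k`). [folklore] -/
def tcPoly (p : Polynomial ℕ) (k : ℕ) : Polynomial ℕ :=
  (X ^ k + 1) * (4 * (X ^ k + (X ^ k + 1)) + 11) + 1 + X ^ k * (p.comp (X ^ k) + X ^ k)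

/-- `tcPoly` evaluates to `tcSize` at `m = n^k`. [folklore] -/
theorem eval_tcPoly (p : Polynomial ℕ) (k n : ℕ) : (tcPoly p k).eval n = tcSize p (n ^ k) := by
  simp [tcPoly, tcSize, eval_comp]

/-- The size bound is at least `1` (room for the constant circuit). [folklore] -/
theorem one_le_eval_tcPoly (p : Polynomial ℕ) (k n : ℕ) : 1 ≤ (tcPoly p k).eval n := by
  rw [eval_tcPoly, tcSize]; omega

/-- **The hash of the padded instance is a `TC⁰` function of depth `d + 5`**, given depth-`d`
size-`p(m)` threshold circuits for the bits of the instance (Thm. 4.5). [cite: NaorReingold2004, Thm. 4.5 (p. 252); Vollmer1999, §1.4.1 (Thm. 1.37)] -/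
theorem acRealOver_hash_of_bits {n m P g d : ℕ} {p : Polynomial ℕ}
    (a : Fin (m + 1) → ℕ) (r : Fin m → Bool)
    (hbits : ∀ j : Fin m, ∃ C : Circuit (Fin m), C.IsOver tcBasis ∧ C.acDepth ≤ d ∧ C.size ≤ p.eval m ∧
      C.Computes fun y => (nrFun P g a y).val.testBit j) :
    ACRealOver tcBasis (fun x : Fin n → Bool => (#{l : Fin m | r l && (nrFun P g a (ext n m x)).val.testBit l}).bodd)
      (4 + (d + 1)) (tcSize p m) := by
  -- the masked output bits as one realized layer over the `n` inputs
  have hlayer : ∀ l : Fin m, ACRealOver tcBasis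
      (fun x : Fin n → Bool => r l && (nrFun P g a (ext n m x)).val.testBit l) (d + 1) (p.eval m + m) := by
    intro l
    cases hr : r l
    · exact ((acRealOver_const (ι := Fin n) acBasis_subset_tcBasis false).mono (by omega)
        (by have := l.isLt; omega)).congr fun x => by simp
    · obtain ⟨C, hC, hdC, hsC, hcomp⟩ := hbits l
      have hin : ∀ i : Fin m, ACRealOver tcBasis (fun x : Fin n → Bool => ext n m x i) 1 1 := by
        intro i
        by_cases hi : i.val < n
        · exact ((acRealOver_input tcBasis (⟨i.val, hi⟩ : Fin n)).mono zero_le_one zero_le_one).congr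
            fun x => by simp [ext, hi]
        · exact (acRealOver_const (ι := Fin n) acBasis_subset_tcBasis false).congr fun x => by simp [ext, hi]
      have hc := acRealOver_circuit_comp C hC hin
      refine (hc.congr fun x => ?_).mono (by omega) (by simp; omega)
      simp only [hcomp _, Bool.true_and]
  have hvec : ACVecOver tcBasis (fun (x : Fin n → Bool) (l : Fin m) => r l && (nrFun P g a (ext n m x)).val.testBit l)
      (d + 1) (m * (p.eval m + m)) := by
    have h := acVecOver_ofBlocks_fintype_const hlayer
    rwa [Fintype.card_fin] at h
  have hpar := ACVecOver.wsumPred hvec (fun _ => 1) (R := m + 1) (by simp) Odd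
  refine (hpar.congr fun x => ?_).mono le_rfl (by simp [tcSize])
  rw [wsum_one, Bool.eq_iff_iff, decide_eq_true_iff, ← bodd_eq_true_iff_odd]
where
  /-- `bodd n = true ↔ n` is odd. [folklore] -/
  bodd_eq_true_iff_odd (c : ℕ) : c.bodd = true ↔ Odd c := by
    rw [Nat.odd_iff, Nat.mod_two_of_bodd]
    cases c.bodd <;> simp

/-- **The keyed family is in `TC⁰`, given Theorem 4.5.** [cite: NaorReingold2004, Thm. 4.5 (p. 252) and p. 237] -/
theorem familyIn_TC0 (h45 : NaorReingold2004_thm45) (hk : 1 ≤ σ.k) : FamilyIn TC0 σ.family := by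
  obtain ⟨d, p, h45⟩ := h45
  intro s
  -- one circuit per length
  have hC : ∀ n, ∃ C : Circuit (Fin n), C.IsOver tcBasis ∧ C.acDepth ≤ 4 + (d + 1) ∧
      C.size ≤ (tcPoly p σ.k).eval n ∧ C.Computes (σ.family n (s n)) := by
    intro n
    by_cases hinst : σ.IsInst n
    · have hnm : n ≤ σ.m n := by
        rw [Seq.m]; exact Nat.le_self_pow (by omega) n
      have hQ : 0 < σ.Q (σ.m n) := hinst.prime_Q.pos
      have hg : (σ.g (σ.m n) : ZMod (σ.P (σ.m n))) ^ σ.Q (σ.m n) = 1 := by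
        rw [← hinst.orderOf_eq]; exact pow_orderOf_eq_one _
      set K : Fin (n + 1) → ℕ := fun i => ((σ.parse n (s n)).1 i).val with hK
      set r : Fin (σ.m n) → Bool := (σ.parse n (s n)).2 with hr
      set a := extKey n (σ.m n) (σ.Q (σ.m n)) K with ha
      have hbits := fun j => h45 (σ.m n) (σ.P (σ.m n)) (σ.Q (σ.m n)) (σ.g (σ.m n)) a hinst
        (fun i => extKey_lt hQ K i) j
      have hreal := acRealOver_hash_of_bits (n := n) a r hbits
      obtain ⟨C, hB, hdep, hsz, hcomp⟩ := hreal.toCircuit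
      refine ⟨C, hB, hdep, by rw [eval_tcPoly]; exact hsz, fun x => ?_⟩
      rw [hcomp x, family, if_pos hinst]
      change _ = innerBit r (fun l => (nrFun (σ.P (σ.m n)) (σ.g (σ.m n)) K x).val.testBit l)
      rw [nrFun_ext hnm hQ hg K x, innerBit]
    · refine ⟨Circuit.const (Fin n) false, (Circuit.const_isOver_acBasis false).mono acBasis_subset_tcBasis,
        ?_, ?_, fun x => ?_⟩
      · have : (Circuit.const (Fin n) false).acDepth = 1 := rfl
        omega
      · rw [Circuit.size_const]; exact one_le_eval_tcPoly p σ.k n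
      · rw [Circuit.eval_const, family_of_not_isInst hinst]
  choose C hB hdep hsz hcomp using hC
  refine ⟨4 + (d + 1), tcPoly p σ.k, C, fun n => ⟨hB n, hdep n, hsz n⟩, fun x => ?_⟩
  rw [hcomp x.length x.get]
  have h1 : (keyedLanguage σ.family s).sliceFn x.length x.get = σ.family x.length (s x.length) x.get := by
    rw [sliceFn_keyedLanguage]
  rw [← h1, Language.sliceFn, List.ofFn_get]

end Seq

end NaorReingold

end Literature.Computability.Cryptography

end
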